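import Literature.MathematicalPhysics.QuantumFieldTheory.Balaban1983to89.B9Cor36GpDirAtMemberBlocks
import Literature.MathematicalPhysics.QuantumFieldTheory.Balaban1983to89.B9CubeSequence408MirrorsStencil
import Literature.MathematicalPhysics.QuantumFieldTheory.Balaban1983to89.B9SectBGpReadingsY
import Literature.MathematicalPhysics.QuantumFieldTheory.Balaban1983to89.Node00.OpsYSectDCoords

/-!
# `Balaban1983to89.B9Cor36GpDirMemberBlocksAtRecordY` — T. Bałaban, *Propagators for lattice gauge theories in a background field*, Commun. Math. Phys. **99** (1985)
# 389–434 [Balaban1985BackgroundPropagators], COROLLARY 3.6 p. 408 («all the results of these theorems are gauge invariant») with (3.42) p. 397 FOR THE SEQUENCE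
# `{Ω_n(□)}` (p. 409 l. 1–5), READ ON THE MEMBER's BLOCKS: dag-n06-c's `B9Cor36GpDirAtMemberBlocks.gpDir_at_member_blocks` AT THE N06 RECORD — its existential
# constants NAMED, its (3.35) datum BUNDLED, and the N06 heads' row `h36b` derived at any dominated pair `(B_c, δ₀)`.

statement-level skeleton of published theorems with citation tags; proofs where landed; nothing here is a claim about the Yang–Mills mass gap

WHY THIS FILE (cell `pub-ymgap`, node N06 [B9], seat `pub-ymgap-dag-n06-d` g33 — the knit at ₁₁).  The heads of record «KESC-AγH» ∕ «KE₁₄X-Aγ» display the site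
estimate row `h36b` (the four (3.42) block majorants of `η²G′_□(U)` at the (β) letter `GpDirY x □ (parKnitCubeY x □) (dirDomY x □)`, over the member's all-blocks geometry
`toB6 (geoBY x) 1 (H x)`, basis `trBasis N`, constants `(Bc, p.δ₀)` of the certificate).  dag-n06-c's UNIT 10 proves exactly these four clauses, for every member above
three thresholds and every cube, MODULO a (3.35) datum of `Ω₀(□)` (a gauge `u` straightening `U` to `e^{iηA}` with `A` small on a box `Q ⊇ chart⁻¹Ω₀(□)`, collar
geometry, p06's window numerics) — LOCATED-32: the record's class (3.35) supplies such data on class cubes only.  The supplier's conclusion is ∃-packaged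
(`∃ δ B_m M₀ T₀ N₀ a₁, …`); a certificate that displays the smallness as numerics on its own parameters needs the six constants as CLOSED TERMS (pattern of
✓`B9Thm311KnitRow17ThresholdsY`).  THIS FILE:
* §1 ★ `Datum36Y i □ U a₁` — the (3.35) DATUM OF `Ω₀(□)` AT `U`: UNIT 10's datum hypotheses (`g A Q C ξ Λ α₀′` and their 17 rows, those that mention the datum) bundled
  VERBATIM into one existential predicate; `CollarS2Y i □` — its datum-free collar geometry row `hS2`.
* §2 the named constants `gpd36δ ∕ gpd36B ∕ gpd36M₀ ∕ gpd36T₀ ∕ gpd36N₀ ∕ gpd36a₁ (N d ℓ hL)` (`Classical.choose` of `gpDir_at_member_blocks` at `b := trBasis N`,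
  `M₂ := coordBound39 (trBasis N)`, `hrepr := abs_repr_le`), ★ `gpDir_at_member_blocks_at` (UNIT 10 restated at the named constants), `gpd36δ_pos`, `gpd36B_nonneg`, `gpd36a₁_pos`.
* §1 also ★ `collarS2Y`: the collar row HOLDS (dag-n06-c ✓`hS2_dirDomY`).
* §3 ★★ `h36b_at_member`: at a member `x` above the named thresholds, for every `U` carrying a `Datum36Y` at every cube, THE FOUR CLAUSES OF
  THE HEADS' `h36b` at `x, U` — in the heads' currency (`geoBY x = geoBK x.toKIdx` by `rfl`, `etaS x.toKIdx = (kGeo x.toKIdx).eta` by ✓`etaS_eq_eta`, `Rr := 1`) and at ANY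
  `(Bc, δ₀)` with `gpd36B ≤ Bc`, `δ₀ ≤ gpd36δ` (kernel monotonicity).
HONEST SCOPE.  Naming, bundling, unpacking and one kernel comparison over a landed theorem; Cor. 3.6's estimate itself is dag-n06-c's UNIT 10 (USED, not re-proved);
the datum is DISPLAYED, not constructed (LOCATED-32 stands).  Count-neutral; N06 NOT discharged; nothing continuum ∕ OS ∕ mass gap ∕ Clay.  NEW file (definition lane:
2 predicates + 6 named constants with bodies; theorems sorry-free); nothing landed is modified.
-/

noncomputable section

namespace Literature.MathematicalPhysics.QuantumFieldTheory.Balaban1983to89.B9Cor36GpDirMemberBlocksAtRecordY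

open B6RandomWalk (HasMajorant hasMajorant_mono)
open B9Thm34Ext (toB6)
open B9Eq352DivFormLetters (conj)
open B9Eq352GradLetters (diffLetter)
open B9Eq39Adjoint (R fluct covD)
open B6KLevelCensusIndexV1 (KIdx kGeo)
open B6Cover236MultiLevelBlocks (cubes)
open B6GlobalChartV1 (PV boxEquiv)
open B6Geom246MultiLevelBox (blkOf)
open B9BackgroundsKLevelV1 (shiftsV1)
open B9Eq360DeltaPrimeAY (AfldY)
open B9CubeLettersOpsL0 (levCubeY)
open B9CubeGeometryInputs (RM1)
open B9Cor35GpDirInputsAtOne (dirDomY)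
open B9Cor36GpDirAtMemberBlocks (gpDir_at_member_blocks)
open B9SectBAllBlocksGeometryY (geoBK geoBY geoBK_len_pos geoBK_dist_nonneg)
open B9SectBGpReadingsY (etaS_eq_eta)
open B9PinMembersKLevelV1 (MemberY)
open B9Thm39ReadingCoords (coordBound39 abs_repr_le)
open B9CoReadingCoordsTranspose (TrIdx trBasis)
open B7Prop2Explicit (C0 c2')
open B7Prop3Flat (c3)
open Node00 (SiteY CfgY GaugeY toKT shiftY gaugeY UboxY lapSL etaS)
open Node00.OpsYCubeDirInverse (padDeltaCubeY GpDirY)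
open Node00.OpsYCubeKnitPar (parKnitCubeY)
open scoped Matrix Matrix.Norms.L2Operator

/-! ## §1 The (3.35) datum of `Ω₀(□)` at `U` (UNIT 10's datum hypotheses, bundled) and the collar geometry row -/

section Datum

variable {d ℓ : ℕ} {hd : 1 ≤ d + 1} {hL : Odd (ℓ + 1) ∧ 1 < ℓ + 1} {b₀ b₁ : ℝ} {N : ℕ}

/-- ★ **THE (3.35) DATUM OF `Ω₀(□)` AT `U` WITH SMALLNESS THRESHOLD `a₁`** — dag-n06-c's UNIT 10 hypotheses that mention the datum, VERBATIM: a gauge `g`, a field `A` and a box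
`Q ⊇ chart⁻¹Ω₀(□)` with `Uᵍ = e^{iηA}` on the bonds of `Q`, `‖A‖ ≤ Cξ⁻¹`, `‖η⁻¹∂A‖ ≤ Cξ⁻²` on `Q`, `η ≤ ξ`, `1 ≤ Λ`, `L^{n+1}η ≤ Λξ`, `2CΛ² ≤ min(a₁, ¼)`, p06's window numerics
at `α₀′` and `2CΛ²`, and the bi-contractivity of `R(Uᵍ)` and of `g` (print: the class (3.35) p. 396 read on a cube ⊇ Ω₀(□), p. 408 «□⁵ is contained in one of the cubes for which this
condition holds»; LOCATED-32: NOT supplied by the record's class cubes). [cite: Balaban1985BackgroundPropagators, (3.35) p.396, Cor. 3.6 p.408 l.1–14, p.409 l.1–5] -/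
def Datum36Y (i : KIdx d ℓ hd hL b₀ b₁) (c : ↥(cubes (toKT i).D.toDomains)) (U : CfgY (Matrix (Fin N) (Fin N) ℂ) i) (a₁ : ℝ) : Prop :=
  ∃ (g : GaugeY (Matrix (Fin N) (Fin N) ℂ) i) (A : AfldY (Matrix (Fin N) (Fin N) ℂ) i) (Q : Set (Site (PV d ℓ i.m i.K hd hL) 0)) (C ξ Λ α₀' : ℝ),
    0 ≤ C ∧ (kGeo i).eta ≤ ξ ∧ 1 ≤ Λ ∧ LatticeNorms.scaleLen ((ℓ : ℝ) + 1) (kGeo i).eta (c.1.1 + 1) ≤ Λ * ξ ∧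
    (∀ z ∈ dirDomY i c, (boxEquiv i.hN).symm z ∈ Q) ∧
    (∀ (κ : Fin (d + 1)) (x : Site (PV d ℓ i.m i.K hd hL) 0), x ∈ Q → x.shift κ ∈ Q → gaugeY i g U κ x = fluct (kGeo i).eta A κ x) ∧
    (∀ κ, ∀ x ∈ Q, ‖A κ x‖ ≤ C * ξ⁻¹) ∧
    (∀ μ ν, ∀ x ∈ Q, ‖(((kGeo i).eta : ℂ)⁻¹) • covD (shiftsV1 (PV d ℓ i.m i.K hd hL)) (fun _ _ => (1 : (Matrix (Fin N) (Fin N) ℂ)ˣ)) μ (A ν) x‖ ≤ C * (ξ ^ 2)⁻¹) ∧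
    2 * C * Λ ^ 2 ≤ a₁ ∧ 2 * C * Λ ^ 2 ≤ 1 / 4 ∧
    0 < α₀' ∧ C0 (d + 1) * α₀' ≤ 1 / 3 ∧ 4 * α₀' ≤ c2' (d + 1) (ℓ + 1) ∧
    Real.exp (4 * (800 * (((d + 1 : ℕ) : ℝ) + 1) ^ 2 * (((d + 1 : ℕ) : ℝ) + 4)) * α₀') * (1 + 8 * (131072 * (((d + 1 : ℕ) : ℝ) + 1) ^ 2) * (2 * C * Λ ^ 2)) ≤ 2 ∧
    2 * (2 * C * Λ ^ 2) ≤ c3 (d + 1) (ℓ + 1) ∧ 4096 * ((d + 1 : ℕ) : ℝ) * (2 * C * Λ ^ 2) ≤ 1 ∧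
    (∀ (μ : Fin (d + 1)) (z : SiteY i) (a : Matrix (Fin N) (Fin N) ℂ),
      ‖R (UboxY i (gaugeY i g U) μ z) a‖ ≤ ‖a‖ ∧ ‖R (UboxY i (gaugeY i g U) μ z)⁻¹ a‖ ≤ ‖a‖) ∧
    (∀ x, ‖((g x : (Matrix (Fin N) (Fin N) ℂ)ˣ) : Matrix (Fin N) (Fin N) ℂ)‖ ≤ 1 ∧ ‖(((g x)⁻¹ : (Matrix (Fin N) (Fin N) ℂ)ˣ) : Matrix (Fin N) (Fin N) ℂ)‖ ≤ 1)

/-- **THE COLLAR GEOMETRY ROW `hS2` OF `Ω₀(□)`** (datum-free): every site of cube level `≥ 1` lies in `Ω₀(□)` together with its 2-step lattice stencil.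
[cite: Balaban1985BackgroundPropagators, p.408 («Ω₀(□) ⊂ □⁵», the sequence {Ω_n(□)}), bookkeeping] -/
def CollarS2Y (i : KIdx d ℓ hd hL b₀ b₁) (c : ↥(cubes (toKT i).D.toDomains)) : Prop :=
  ∀ z : SiteY i, 1 ≤ levCubeY i c z → z ∈ dirDomY i c ∧ ∀ μ, shiftY i μ z ∈ dirDomY i c ∧ (shiftY i μ).symm z ∈ dirDomY i c ∧
    ∀ ν, shiftY i ν (shiftY i μ z) ∈ dirDomY i c ∧ shiftY i ν ((shiftY i μ).symm z) ∈ dirDomY i c ∧ (shiftY i ν).symm ((shiftY i μ).symm z) ∈ dirDomY i c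

/-- ★ the collar row HOLDS at print's placement (dag-n06-c ✓`B9CubeSequence408MirrorsStencil.hS2_dirDomY`: a site of cube level `≥ 1` lies in `C₁(□)`, two lattice steps
inside the open mirror box). [cite: Balaban1985BackgroundPropagators, p.408 («Ω₀(□) ⊂ □⁵»), bookkeeping] -/
theorem collarS2Y (i : KIdx d ℓ hd hL b₀ b₁) (c : ↥(cubes (toKT i).D.toDomains)) : CollarS2Y i c := fun z hz =>
  B9CubeSequence408MirrorsStencil.hS2_dirDomY i c z hz

end Datum

/-! ## §2 The six existential constants of UNIT 10 at the record's basis `trBasis N`, named -/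

section Constants

variable (N : ℕ) [Nonempty (Fin N)] (d ℓ : ℕ) (hL : Odd (ℓ + 1) ∧ 1 < ℓ + 1)

include hL in
/-- dag-n06-c's UNIT 10 at the record's basis `trBasis N` (`M₂ := coordBound39 (trBasis N)`, ✓`abs_repr_le`; `1 ≤ L − 1` from `hL`) — restated verbatim for the naming below.
[cite: Balaban1985BackgroundPropagators, Cor. 3.6 p.408 l.1–14, Thm 3.1 (3.42) p.397, p.409 l.1–5] -/
private theorem ex36 :
    ∃ δ Bm M₀ T₀ : ℝ, ∃ N₀ : ℕ, 0 < δ ∧ 0 ≤ Bm ∧ ∃ a₁ : ℝ, 0 < a₁ ∧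
    ∀ {hd : 1 ≤ d + 1} {hL : Odd (ℓ + 1) ∧ 1 < ℓ + 1} {b₀ b₁ : ℝ} (i : KIdx d ℓ hd hL b₀ b₁) (c : ↥(cubes (toKT i).D.toDomains)),
      M₀ ≤ ((ℓ : ℝ) + 1) * (toKT i).Mh → N₀ + 1 ≤ (toKT i).R * ((ℓ + 1) * (toKT i).Mh) → T₀ ≤ RM1 i →
    ∀ (g : GaugeY (Matrix (Fin N) (Fin N) ℂ) i) (U : CfgY (Matrix (Fin N) (Fin N) ℂ) i) (A : AfldY (Matrix (Fin N) (Fin N) ℂ) i)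
      (Q : Set (Site (PV d ℓ i.m i.K hd hL) 0)) (C ξ Λ α₀' : ℝ),
      0 ≤ C → (kGeo i).eta ≤ ξ → 1 ≤ Λ → LatticeNorms.scaleLen ((ℓ : ℝ) + 1) (kGeo i).eta (c.1.1 + 1) ≤ Λ * ξ →
      (∀ z ∈ dirDomY i c, (boxEquiv i.hN).symm z ∈ Q) →
      (∀ (κ : Fin (d + 1)) (x : Site (PV d ℓ i.m i.K hd hL) 0), x ∈ Q → x.shift κ ∈ Q → gaugeY i g U κ x = fluct (kGeo i).eta A κ x) →
      (∀ κ, ∀ x ∈ Q, ‖A κ x‖ ≤ C * ξ⁻¹) →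
      (∀ μ ν, ∀ x ∈ Q, ‖(((kGeo i).eta : ℂ)⁻¹) • covD (shiftsV1 (PV d ℓ i.m i.K hd hL)) (fun _ _ => (1 : (Matrix (Fin N) (Fin N) ℂ)ˣ)) μ (A ν) x‖ ≤ C * (ξ ^ 2)⁻¹) →
      (∀ z : SiteY i, 1 ≤ levCubeY i c z → z ∈ dirDomY i c ∧ ∀ μ, shiftY i μ z ∈ dirDomY i c ∧ (shiftY i μ).symm z ∈ dirDomY i c ∧
        ∀ ν, shiftY i ν (shiftY i μ z) ∈ dirDomY i c ∧ shiftY i ν ((shiftY i μ).symm z) ∈ dirDomY i c ∧ (shiftY i ν).symm ((shiftY i μ).symm z) ∈ dirDomY i c) →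
      2 * C * Λ ^ 2 ≤ a₁ → 2 * C * Λ ^ 2 ≤ 1 / 4 →
      0 < α₀' → C0 (d + 1) * α₀' ≤ 1 / 3 → 4 * α₀' ≤ c2' (d + 1) (ℓ + 1) →
      Real.exp (4 * (800 * (((d + 1 : ℕ) : ℝ) + 1) ^ 2 * (((d + 1 : ℕ) : ℝ) + 4)) * α₀') * (1 + 8 * (131072 * (((d + 1 : ℕ) : ℝ) + 1) ^ 2) * (2 * C * Λ ^ 2)) ≤ 2 →
      2 * (2 * C * Λ ^ 2) ≤ c3 (d + 1) (ℓ + 1) → 4096 * ((d + 1 : ℕ) : ℝ) * (2 * C * Λ ^ 2) ≤ 1 →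
      (∀ (μ : Fin (d + 1)) (z : SiteY i) (a : Matrix (Fin N) (Fin N) ℂ),
        ‖R (UboxY i (gaugeY i g U) μ z) a‖ ≤ ‖a‖ ∧ ‖R (UboxY i (gaugeY i g U) μ z)⁻¹ a‖ ≤ ‖a‖) →
      (∀ x, ‖((g x : (Matrix (Fin N) (Fin N) ℂ)ˣ) : Matrix (Fin N) (Fin N) ℂ)‖ ≤ 1 ∧ ‖(((g x)⁻¹ : (Matrix (Fin N) (Fin N) ℂ)ˣ) : Matrix (Fin N) (Fin N) ℂ)‖ ≤ 1) →
    ∀ [Fintype (geoBK i).Site] (Rr : ℝ) (Hp : Prop),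
      IsUnit (padDeltaCubeY i c (parKnitCubeY i c) (dirDomY i c) (gaugeY i g U)) ∧
      HasMajorant (g := toB6 (geoBK i) Rr Hp) (fun p : SiteY i × TrIdx N => blkOf i.D.toDomains p.1)
        (conj (trBasis N) (((kGeo i).eta ^ 2) • (GpDirY i c (parKnitCubeY i c) (dirDomY i c) U).restrictScalars ℝ))
        (fun a a' => Bm * (geoBK i).len a ^ 2 * Real.exp (-(δ * (geoBK i).dist a a'))) ∧
      (∀ μ : Fin (d + 1), HasMajorant (g := toB6 (geoBK i) Rr Hp) (fun p : SiteY i × TrIdx N => blkOf i.D.toDomains p.1)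
        (conj (trBasis N) (diffLetter (shiftY i) (UboxY i U) ((((kGeo i).eta : ℂ))⁻¹) (Sum.inl μ)) *
          conj (trBasis N) (((kGeo i).eta ^ 2) • (GpDirY i c (parKnitCubeY i c) (dirDomY i c) U).restrictScalars ℝ))
        (fun a a' => Bm * (geoBK i).len a * Real.exp (-(δ * (geoBK i).dist a a')))) ∧
      (∀ μ : Fin (d + 1), HasMajorant (g := toB6 (geoBK i) Rr Hp) (fun p : SiteY i × TrIdx N => blkOf i.D.toDomains p.1)
        (conj (trBasis N) (((kGeo i).eta ^ 2) • (GpDirY i c (parKnitCubeY i c) (dirDomY i c) U).restrictScalars ℝ) *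
          conj (trBasis N) (diffLetter (shiftY i) (UboxY i U) ((((kGeo i).eta : ℂ))⁻¹) (Sum.inr μ)))
        (fun a a' => Bm * (geoBK i).len a * Real.exp (-(δ * (geoBK i).dist a a')))) ∧
      HasMajorant (g := toB6 (geoBK i) Rr Hp) (fun p : SiteY i × TrIdx N => blkOf i.D.toDomains p.1)
        (conj (trBasis N) ((((kGeo i).eta ^ 2)⁻¹ : ℝ) • (lapSL i U).restrictScalars ℝ) *
          conj (trBasis N) (((kGeo i).eta ^ 2) • (GpDirY i c (parKnitCubeY i c) (dirDomY i c) U).restrictScalars ℝ))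
        (fun a a' => Bm * 1 * Real.exp (-(δ * (geoBK i).dist a a'))) :=
  gpDir_at_member_blocks (trBasis N) d ℓ (Nat.lt_succ_iff.mp hL.2) (coordBound39 (trBasis N)) (norm_nonneg _) (abs_repr_le (trBasis N))

/-- **the decay rate `δ` of Cor. 3.6 for `G′_□` on the member's blocks, NAMED** (a function of `d, L, N`). [cite: Balaban1985BackgroundPropagators, Cor. 3.6 p.408, (3.42) p.397] -/
def gpd36δ : ℝ := (ex36 N d ℓ hL).choose

/-- **the constant `B_m` of the four majorants, NAMED**. [cite: Balaban1985BackgroundPropagators, Cor. 3.6 p.408, (3.42) p.397] -/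
def gpd36B : ℝ := (ex36 N d ℓ hL).choose_spec.choose

/-- **the threshold `M₀` («M sufficiently large»), NAMED**. [cite: Balaban1985BackgroundPropagators, (3.35) p.396, Cor. 3.6 p.408] -/
def gpd36M₀ : ℝ := (ex36 N d ℓ hL).choose_spec.choose_spec.choose

/-- **the threshold `T₀` (`T₀ ≤ RM`), NAMED**. [cite: Balaban1985BackgroundPropagators, Cor. 3.6 p.408; Balaban1984PropagatorsII, Lemma 2.1 p.234] -/
def gpd36T₀ : ℝ := (ex36 N d ℓ hL).choose_spec.choose_spec.choose_spec.choose

/-- **the threshold `N₀` (`N₀ + 1 ≤ R·L·M_h`), NAMED**. [cite: Balaban1985BackgroundPropagators, Cor. 3.6 p.408, bookkeeping] -/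
def gpd36N₀ : ℕ := (ex36 N d ℓ hL).choose_spec.choose_spec.choose_spec.choose_spec.choose

/-- **the smallness threshold `a₁` (`2CΛ² ≤ a₁`), NAMED**. [cite: Balaban1985BackgroundPropagators, (3.35) p.396 («α₀ sufficiently small»), Cor. 3.6 p.408] -/
def gpd36a₁ : ℝ := (ex36 N d ℓ hL).choose_spec.choose_spec.choose_spec.choose_spec.choose_spec.2.2.choose

/-- ★ **UNIT 10 AT THE NAMED CONSTANTS** (the defining property of the six names, unpacked once): `0 < gpd36δ`, `0 ≤ gpd36B`, `0 < gpd36a₁`, and Cor. 3.6's four block majorants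
of `η²G′_□(U)` on the member's blocks for every member above `(gpd36M₀, gpd36N₀, gpd36T₀)`, every cube, every (3.35) datum with `2CΛ² ≤ gpd36a₁`.
[cite: Balaban1985BackgroundPropagators, Cor. 3.6 p.408 l.1–14, Thm 3.1 (3.42) p.397, p.409 l.1–5, (3.35) p.396; Balaban1984PropagatorsII, (2.51)–(2.55) p.232] -/
theorem gpDir_at_member_blocks_at : 0 < gpd36δ N d ℓ hL ∧ 0 ≤ gpd36B N d ℓ hL ∧ 0 < gpd36a₁ N d ℓ hL ∧
    ∀ {hd : 1 ≤ d + 1} {hL : Odd (ℓ + 1) ∧ 1 < ℓ + 1} {b₀ b₁ : ℝ} (i : KIdx d ℓ hd hL b₀ b₁) (c : ↥(cubes (toKT i).D.toDomains)),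
      gpd36M₀ N d ℓ hL ≤ ((ℓ : ℝ) + 1) * (toKT i).Mh → gpd36N₀ N d ℓ hL + 1 ≤ (toKT i).R * ((ℓ + 1) * (toKT i).Mh) → gpd36T₀ N d ℓ hL ≤ RM1 i →
    ∀ (g : GaugeY (Matrix (Fin N) (Fin N) ℂ) i) (U : CfgY (Matrix (Fin N) (Fin N) ℂ) i) (A : AfldY (Matrix (Fin N) (Fin N) ℂ) i)
      (Q : Set (Site (PV d ℓ i.m i.K hd hL) 0)) (C ξ Λ α₀' : ℝ),
      0 ≤ C → (kGeo i).eta ≤ ξ → 1 ≤ Λ → LatticeNorms.scaleLen ((ℓ : ℝ) + 1) (kGeo i).eta (c.1.1 + 1) ≤ Λ * ξ →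
      (∀ z ∈ dirDomY i c, (boxEquiv i.hN).symm z ∈ Q) →
      (∀ (κ : Fin (d + 1)) (x : Site (PV d ℓ i.m i.K hd hL) 0), x ∈ Q → x.shift κ ∈ Q → gaugeY i g U κ x = fluct (kGeo i).eta A κ x) →
      (∀ κ, ∀ x ∈ Q, ‖A κ x‖ ≤ C * ξ⁻¹) →
      (∀ μ ν, ∀ x ∈ Q, ‖(((kGeo i).eta : ℂ)⁻¹) • covD (shiftsV1 (PV d ℓ i.m i.K hd hL)) (fun _ _ => (1 : (Matrix (Fin N) (Fin N) ℂ)ˣ)) μ (A ν) x‖ ≤ C * (ξ ^ 2)⁻¹) →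
      (∀ z : SiteY i, 1 ≤ levCubeY i c z → z ∈ dirDomY i c ∧ ∀ μ, shiftY i μ z ∈ dirDomY i c ∧ (shiftY i μ).symm z ∈ dirDomY i c ∧
        ∀ ν, shiftY i ν (shiftY i μ z) ∈ dirDomY i c ∧ shiftY i ν ((shiftY i μ).symm z) ∈ dirDomY i c ∧ (shiftY i ν).symm ((shiftY i μ).symm z) ∈ dirDomY i c) →
      2 * C * Λ ^ 2 ≤ gpd36a₁ N d ℓ hL → 2 * C * Λ ^ 2 ≤ 1 / 4 →
      0 < α₀' → C0 (d + 1) * α₀' ≤ 1 / 3 → 4 * α₀' ≤ c2' (d + 1) (ℓ + 1) →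
      Real.exp (4 * (800 * (((d + 1 : ℕ) : ℝ) + 1) ^ 2 * (((d + 1 : ℕ) : ℝ) + 4)) * α₀') * (1 + 8 * (131072 * (((d + 1 : ℕ) : ℝ) + 1) ^ 2) * (2 * C * Λ ^ 2)) ≤ 2 →
      2 * (2 * C * Λ ^ 2) ≤ c3 (d + 1) (ℓ + 1) → 4096 * ((d + 1 : ℕ) : ℝ) * (2 * C * Λ ^ 2) ≤ 1 →
      (∀ (μ : Fin (d + 1)) (z : SiteY i) (a : Matrix (Fin N) (Fin N) ℂ),
        ‖R (UboxY i (gaugeY i g U) μ z) a‖ ≤ ‖a‖ ∧ ‖R (UboxY i (gaugeY i g U) μ z)⁻¹ a‖ ≤ ‖a‖) →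
      (∀ x, ‖((g x : (Matrix (Fin N) (Fin N) ℂ)ˣ) : Matrix (Fin N) (Fin N) ℂ)‖ ≤ 1 ∧ ‖(((g x)⁻¹ : (Matrix (Fin N) (Fin N) ℂ)ˣ) : Matrix (Fin N) (Fin N) ℂ)‖ ≤ 1) →
    ∀ [Fintype (geoBK i).Site] (Rr : ℝ) (Hp : Prop),
      IsUnit (padDeltaCubeY i c (parKnitCubeY i c) (dirDomY i c) (gaugeY i g U)) ∧
      HasMajorant (g := toB6 (geoBK i) Rr Hp) (fun p : SiteY i × TrIdx N => blkOf i.D.toDomains p.1)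
        (conj (trBasis N) (((kGeo i).eta ^ 2) • (GpDirY i c (parKnitCubeY i c) (dirDomY i c) U).restrictScalars ℝ))
        (fun a a' => gpd36B N d ℓ hL * (geoBK i).len a ^ 2 * Real.exp (-(gpd36δ N d ℓ hL * (geoBK i).dist a a'))) ∧
      (∀ μ : Fin (d + 1), HasMajorant (g := toB6 (geoBK i) Rr Hp) (fun p : SiteY i × TrIdx N => blkOf i.D.toDomains p.1)
        (conj (trBasis N) (diffLetter (shiftY i) (UboxY i U) ((((kGeo i).eta : ℂ))⁻¹) (Sum.inl μ)) *
          conj (trBasis N) (((kGeo i).eta ^ 2) • (GpDirY i c (parKnitCubeY i c) (dirDomY i c) U).restrictScalars ℝ))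
        (fun a a' => gpd36B N d ℓ hL * (geoBK i).len a * Real.exp (-(gpd36δ N d ℓ hL * (geoBK i).dist a a')))) ∧
      (∀ μ : Fin (d + 1), HasMajorant (g := toB6 (geoBK i) Rr Hp) (fun p : SiteY i × TrIdx N => blkOf i.D.toDomains p.1)
        (conj (trBasis N) (((kGeo i).eta ^ 2) • (GpDirY i c (parKnitCubeY i c) (dirDomY i c) U).restrictScalars ℝ) *
          conj (trBasis N) (diffLetter (shiftY i) (UboxY i U) ((((kGeo i).eta : ℂ))⁻¹) (Sum.inr μ)))
        (fun a a' => gpd36B N d ℓ hL * (geoBK i).len a * Real.exp (-(gpd36δ N d ℓ hL * (geoBK i).dist a a')))) ∧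
      HasMajorant (g := toB6 (geoBK i) Rr Hp) (fun p : SiteY i × TrIdx N => blkOf i.D.toDomains p.1)
        (conj (trBasis N) ((((kGeo i).eta ^ 2)⁻¹ : ℝ) • (lapSL i U).restrictScalars ℝ) *
          conj (trBasis N) (((kGeo i).eta ^ 2) • (GpDirY i c (parKnitCubeY i c) (dirDomY i c) U).restrictScalars ℝ))
        (fun a a' => gpd36B N d ℓ hL * 1 * Real.exp (-(gpd36δ N d ℓ hL * (geoBK i).dist a a'))) := by
  have h := (ex36 N d ℓ hL).choose_spec.choose_spec.choose_spec.choose_spec.choose_spec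
  exact ⟨h.1, h.2.1, h.2.2.choose_spec.1, h.2.2.choose_spec.2⟩

/-- `0 < gpd36δ`. [cite: Balaban1985BackgroundPropagators, Cor. 3.6 p.408, bookkeeping] -/
theorem gpd36δ_pos : 0 < gpd36δ N d ℓ hL := (gpDir_at_member_blocks_at N d ℓ hL).1

/-- `0 ≤ gpd36B`. [cite: Balaban1985BackgroundPropagators, Cor. 3.6 p.408, bookkeeping] -/
theorem gpd36B_nonneg : 0 ≤ gpd36B N d ℓ hL := (gpDir_at_member_blocks_at N d ℓ hL).2.1

/-- `0 < gpd36a₁`. [cite: Balaban1985BackgroundPropagators, Cor. 3.6 p.408, bookkeeping] -/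
theorem gpd36a₁_pos : 0 < gpd36a₁ N d ℓ hL := (gpDir_at_member_blocks_at N d ℓ hL).2.2.1

end Constants

/-! ## §3 The heads' row `h36b` at a member, from the datum, at any dominated `(B_c, δ₀)` -/

section Member

variable {N : ℕ} [Nonempty (Fin N)] {Mstar : ℕ}

/-- kernel monotonicity `B_m·l·e^{−δe} ≤ B_c·l·e^{−δ₀e}` for `B_m ≤ B_c`, `δ₀ ≤ δ`, `l, e ≥ 0`. [folklore] -/
private theorem kernel_mono {Bm Bc δ δ₀ l e : ℝ} (hBm : 0 ≤ Bm) (hBc : Bm ≤ Bc) (hδ : δ₀ ≤ δ) (hl : 0 ≤ l) (he : 0 ≤ e) :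
    Bm * l * Real.exp (-(δ * e)) ≤ Bc * l * Real.exp (-(δ₀ * e)) :=
  mul_le_mul (mul_le_mul_of_nonneg_right hBc hl) (Real.exp_le_exp.2 (by nlinarith)) (Real.exp_nonneg _) (mul_nonneg (hBm.trans hBc) hl)

/-- ★★ **THE HEADS' ROW `h36b` AT A MEMBER, FROM THE (3.35) DATUM** (dag-n06-c's ✓`gpDir_at_member_blocks` at the record, unpacked at the named constants): for a member `x` above the
thresholds `gpd36M₀ ≤ L·M_h`, `gpd36N₀ + 1 ≤ R·L·M_h`, `gpd36T₀ ≤ RM1`, a configuration `U` carrying a `Datum36Y … (gpd36a₁ …)` at every cover cube (the collar row is ✓`collarS2Y`), and any `(B_c, δ₀)`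
with `gpd36B ≤ B_c`, `δ₀ ≤ gpd36δ`: the four (3.42) block majorants of `η²G′_□(U)` (entries, left ∕ right covariant derivative, Laplacian) over `toB6 (geoBY x) 1 H` keyed by `Δ(·)`, in the
heads' currency (`etaS`, `trBasis N`). [cite: Balaban1985BackgroundPropagators, Cor. 3.6 p.408 l.1–14, Thm 3.1 (3.42) p.397, p.409 l.1–5, (3.35) p.396; Balaban1984PropagatorsII, (2.51)–(2.55) p.232] -/
theorem h36b_at_member {θd θℓ : ℕ} {θhd : 1 ≤ θd + 1} {θhL : Odd (θℓ + 1) ∧ 1 < θℓ + 1} {θb₀ θb₁ : ℝ}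
    (x : MemberY θd θℓ θhd θhL θb₀ θb₁ Mstar) [Fintype (geoBY x).Site] (H : Prop)
    (hM : gpd36M₀ N θd θℓ θhL ≤ ((θℓ : ℝ) + 1) * (toKT x.toKIdx).Mh) (hN : gpd36N₀ N θd θℓ θhL + 1 ≤ (toKT x.toKIdx).R * ((θℓ + 1) * (toKT x.toKIdx).Mh))
    (hT : gpd36T₀ N θd θℓ θhL ≤ RM1 x.toKIdx) (U : CfgY (Matrix (Fin N) (Fin N) ℂ) x.toKIdx) (hDat : ∀ c' : ↥(cubes x.toKIdx.D.toDomains), Datum36Y x.toKIdx c' U (gpd36a₁ N θd θℓ θhL))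
    {Bc δ₀ : ℝ} (hBc : gpd36B N θd θℓ θhL ≤ Bc) (hδ : δ₀ ≤ gpd36δ N θd θℓ θhL) :
    (∀ c', HasMajorant (g := toB6 (geoBY x) 1 H) (fun p' : SiteY x.toKIdx × TrIdx N => blkOf x.toKIdx.D.toDomains p'.1)
        (conj (trBasis N) ((etaS x.toKIdx ^ 2) • (GpDirY x.toKIdx c' (parKnitCubeY x.toKIdx c') (dirDomY x.toKIdx c') U).restrictScalars ℝ))
        (fun s s' => Bc * (geoBY x).len s ^ 2 * Real.exp (-(δ₀ * (geoBY x).dist s s')))) ∧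
    (∀ c' (μ : Fin (θd + 1)), HasMajorant (g := toB6 (geoBY x) 1 H) (fun p' : SiteY x.toKIdx × TrIdx N => blkOf x.toKIdx.D.toDomains p'.1)
        (conj (trBasis N) (diffLetter (shiftY x.toKIdx) (UboxY x.toKIdx U) (((etaS x.toKIdx : ℂ))⁻¹) (Sum.inl μ)) *
          conj (trBasis N) ((etaS x.toKIdx ^ 2) • (GpDirY x.toKIdx c' (parKnitCubeY x.toKIdx c') (dirDomY x.toKIdx c') U).restrictScalars ℝ))
        (fun s s' => Bc * (geoBY x).len s * Real.exp (-(δ₀ * (geoBY x).dist s s')))) ∧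
    (∀ c' (μ : Fin (θd + 1)), HasMajorant (g := toB6 (geoBY x) 1 H) (fun p' : SiteY x.toKIdx × TrIdx N => blkOf x.toKIdx.D.toDomains p'.1)
        (conj (trBasis N) ((etaS x.toKIdx ^ 2) • (GpDirY x.toKIdx c' (parKnitCubeY x.toKIdx c') (dirDomY x.toKIdx c') U).restrictScalars ℝ) *
          conj (trBasis N) (diffLetter (shiftY x.toKIdx) (UboxY x.toKIdx U) (((etaS x.toKIdx : ℂ))⁻¹) (Sum.inr μ)))
        (fun s s' => Bc * (geoBY x).len s * Real.exp (-(δ₀ * (geoBY x).dist s s')))) ∧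
    (∀ c', HasMajorant (g := toB6 (geoBY x) 1 H) (fun p' : SiteY x.toKIdx × TrIdx N => blkOf x.toKIdx.D.toDomains p'.1)
        (conj (trBasis N) (((etaS x.toKIdx ^ 2)⁻¹) • (lapSL x.toKIdx U).restrictScalars ℝ) *
          conj (trBasis N) ((etaS x.toKIdx ^ 2) • (GpDirY x.toKIdx c' (parKnitCubeY x.toKIdx c') (dirDomY x.toKIdx c') U).restrictScalars ℝ))
        (fun s s' => Bc * 1 * Real.exp (-(δ₀ * (geoBY x).dist s s')))) := by
  have hBm := gpd36B_nonneg N θd θℓ θhL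
  letI : Fintype (geoBK x.toKIdx).Site := (inferInstance : Fintype (geoBY x).Site)
  -- the supplier at one cube, unpacked at the named constants and at the cube's datum
  have key : ∀ c' : ↥(cubes x.toKIdx.D.toDomains),
      HasMajorant (g := toB6 (geoBK x.toKIdx) 1 H) (fun p' : SiteY x.toKIdx × TrIdx N => blkOf x.toKIdx.D.toDomains p'.1)
        (conj (trBasis N) (((kGeo x.toKIdx).eta ^ 2) • (GpDirY x.toKIdx c' (parKnitCubeY x.toKIdx c') (dirDomY x.toKIdx c') U).restrictScalars ℝ))
        (fun a a' => gpd36B N θd θℓ θhL * (geoBK x.toKIdx).len a ^ 2 * Real.exp (-(gpd36δ N θd θℓ θhL * (geoBK x.toKIdx).dist a a'))) ∧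
      (∀ μ : Fin (θd + 1), HasMajorant (g := toB6 (geoBK x.toKIdx) 1 H) (fun p' : SiteY x.toKIdx × TrIdx N => blkOf x.toKIdx.D.toDomains p'.1)
        (conj (trBasis N) (diffLetter (shiftY x.toKIdx) (UboxY x.toKIdx U) ((((kGeo x.toKIdx).eta : ℂ))⁻¹) (Sum.inl μ)) *
          conj (trBasis N) (((kGeo x.toKIdx).eta ^ 2) • (GpDirY x.toKIdx c' (parKnitCubeY x.toKIdx c') (dirDomY x.toKIdx c') U).restrictScalars ℝ))
        (fun a a' => gpd36B N θd θℓ θhL * (geoBK x.toKIdx).len a * Real.exp (-(gpd36δ N θd θℓ θhL * (geoBK x.toKIdx).dist a a')))) ∧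
      (∀ μ : Fin (θd + 1), HasMajorant (g := toB6 (geoBK x.toKIdx) 1 H) (fun p' : SiteY x.toKIdx × TrIdx N => blkOf x.toKIdx.D.toDomains p'.1)
        (conj (trBasis N) (((kGeo x.toKIdx).eta ^ 2) • (GpDirY x.toKIdx c' (parKnitCubeY x.toKIdx c') (dirDomY x.toKIdx c') U).restrictScalars ℝ) *
          conj (trBasis N) (diffLetter (shiftY x.toKIdx) (UboxY x.toKIdx U) ((((kGeo x.toKIdx).eta : ℂ))⁻¹) (Sum.inr μ)))
        (fun a a' => gpd36B N θd θℓ θhL * (geoBK x.toKIdx).len a * Real.exp (-(gpd36δ N θd θℓ θhL * (geoBK x.toKIdx).dist a a')))) ∧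
      HasMajorant (g := toB6 (geoBK x.toKIdx) 1 H) (fun p' : SiteY x.toKIdx × TrIdx N => blkOf x.toKIdx.D.toDomains p'.1)
        (conj (trBasis N) ((((kGeo x.toKIdx).eta ^ 2)⁻¹ : ℝ) • (lapSL x.toKIdx U).restrictScalars ℝ) *
          conj (trBasis N) (((kGeo x.toKIdx).eta ^ 2) • (GpDirY x.toKIdx c' (parKnitCubeY x.toKIdx c') (dirDomY x.toKIdx c') U).restrictScalars ℝ))
        (fun a a' => gpd36B N θd θℓ θhL * 1 * Real.exp (-(gpd36δ N θd θℓ θhL * (geoBK x.toKIdx).dist a a'))) := by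
    intro c'
    obtain ⟨g, A, Q, C, ξ, Λ, α₀', hC, hξ, hΛ, hΛξ, hQ, hgA, hA, hdA, hα₁, hα4, hα', hα3, hα4', hsmall, hc₃, hsm, hR, hg⟩ := hDat c'
    exact ((gpDir_at_member_blocks_at N θd θℓ θhL).2.2.2 x.toKIdx c' hM hN hT g U A Q C ξ Λ α₀' hC hξ hΛ hΛξ hQ hgA hA hdA (collarS2Y x.toKIdx c') hα₁ hα4 hα' hα3 hα4' hsmall hc₃ hsm hR hg 1 H).2
  have hlen : ∀ a : (geoBK x.toKIdx).Site, 0 ≤ (geoBK x.toKIdx).len a := fun a => (geoBK_len_pos x.toKIdx a).le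
  have hdist : ∀ a a' : (geoBK x.toKIdx).Site, 0 ≤ (geoBK x.toKIdx).dist a a' := fun a a' => geoBK_dist_nonneg x.toKIdx a a'
  rw [etaS_eq_eta]
  refine ⟨fun c' => ?_, fun c' μ => ?_, fun c' μ => ?_, fun c' => ?_⟩
  · exact hasMajorant_mono _ (key c').1 fun a a' => kernel_mono hBm hBc hδ (pow_nonneg (hlen a) 2) (hdist a a')
  · exact hasMajorant_mono _ ((key c').2.1 μ) fun a a' => kernel_mono hBm hBc hδ (hlen a) (hdist a a')
  · exact hasMajorant_mono _ ((key c').2.2.1 μ) fun a a' => kernel_mono hBm hBc hδ (hlen a) (hdist a a')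
  · exact hasMajorant_mono _ (key c').2.2.2 fun a a' => kernel_mono hBm hBc hδ zero_le_one (hdist a a')

end Member

/-! ## §4 (v1.1) The datum for a UNITARY gauge at a unitary-valued `U`: the bi-contractivity rows discharged (dag-n06-c ✓`B9Cor36GpDirAtMemberBlocksG`) -/

section Unitary

variable {d ℓ : ℕ} {hd : 1 ≤ d + 1} {hL : Odd (ℓ + 1) ∧ 1 < ℓ + 1} {b₀ b₁ : ℝ} {N : ℕ}

open B7Prop2Explicit (unitaryUnits)
open B9Cor36GpDirAtMemberBlocks (hR_of_unitary hg_of_unitary)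

/-- ★ **THE (3.35) DATUM OF `Ω₀(□)` AT `U` WITH A UNITARY GAUGE** — `Datum36Y` with its two bi-contractivity rows (of `R(Uᵍ_μ(z))^{±1}` and of `g^{±1}`) REPLACED by the
single row `g x ∈ U(N)` (print: (3.35) p. 396 «U is a configuration with values in G», `G ⊂ U(N)` p. 390, the gauge transformation `u` of Cor. 3.6 is G-valued; the
configuration's own unitarity is the record's `Reg335` class membership and is taken separately): a gauge `g`, a field `A` and a box `Q ⊇ chart⁻¹Ω₀(□)` with
`Uᵍ = e^{iηA}` on the bonds of `Q`, `‖A‖ ≤ Cξ⁻¹`, `‖η⁻¹∂A‖ ≤ Cξ⁻²` on `Q`, `η ≤ ξ`, `1 ≤ Λ`, `L^{n+1}η ≤ Λξ`, `2CΛ² ≤ min(a₁, ¼)`, p06's window numerics at `α₀′` and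
`2CΛ²` (LOCATED-32: the datum is NOT supplied by the record's class cubes; displayed by the heads).
[cite: Balaban1985BackgroundPropagators, (3.35) p.396, Cor. 3.6 p.408 l.1–14, p.409 l.1–5] -/
def Datum36UY (i : KIdx d ℓ hd hL b₀ b₁) (c : ↥(cubes (toKT i).D.toDomains)) (U : CfgY (Matrix (Fin N) (Fin N) ℂ) i) (a₁ : ℝ) : Prop :=
  ∃ (g : GaugeY (Matrix (Fin N) (Fin N) ℂ) i) (A : AfldY (Matrix (Fin N) (Fin N) ℂ) i) (Q : Set (Site (PV d ℓ i.m i.K hd hL) 0)) (C ξ Λ α₀' : ℝ),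
    (∀ x, g x ∈ unitaryUnits (Matrix (Fin N) (Fin N) ℂ)) ∧
    0 ≤ C ∧ (kGeo i).eta ≤ ξ ∧ 1 ≤ Λ ∧ LatticeNorms.scaleLen ((ℓ : ℝ) + 1) (kGeo i).eta (c.1.1 + 1) ≤ Λ * ξ ∧
    (∀ z ∈ dirDomY i c, (boxEquiv i.hN).symm z ∈ Q) ∧
    (∀ (κ : Fin (d + 1)) (x : Site (PV d ℓ i.m i.K hd hL) 0), x ∈ Q → x.shift κ ∈ Q → gaugeY i g U κ x = fluct (kGeo i).eta A κ x) ∧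
    (∀ κ, ∀ x ∈ Q, ‖A κ x‖ ≤ C * ξ⁻¹) ∧
    (∀ μ ν, ∀ x ∈ Q, ‖(((kGeo i).eta : ℂ)⁻¹) • covD (shiftsV1 (PV d ℓ i.m i.K hd hL)) (fun _ _ => (1 : (Matrix (Fin N) (Fin N) ℂ)ˣ)) μ (A ν) x‖ ≤ C * (ξ ^ 2)⁻¹) ∧
    2 * C * Λ ^ 2 ≤ a₁ ∧ 2 * C * Λ ^ 2 ≤ 1 / 4 ∧
    0 < α₀' ∧ C0 (d + 1) * α₀' ≤ 1 / 3 ∧ 4 * α₀' ≤ c2' (d + 1) (ℓ + 1) ∧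
    Real.exp (4 * (800 * (((d + 1 : ℕ) : ℝ) + 1) ^ 2 * (((d + 1 : ℕ) : ℝ) + 4)) * α₀') * (1 + 8 * (131072 * (((d + 1 : ℕ) : ℝ) + 1) ^ 2) * (2 * C * Λ ^ 2)) ≤ 2 ∧
    2 * (2 * C * Λ ^ 2) ≤ c3 (d + 1) (ℓ + 1) ∧ 4096 * ((d + 1 : ℕ) : ℝ) * (2 * C * Λ ^ 2) ≤ 1

variable [Nonempty (Fin N)]

/-- ★ **A UNITARY DATUM AT A UNITARY-VALUED `U` IS A `Datum36Y`** — the two bi-contractivity rows by dag-n06-c's ✓`hR_of_unitary`, ✓`hg_of_unitary`.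
[cite: Balaban1985BackgroundPropagators, (3.28) p.395, (3.35) p.396, bookkeeping] -/
theorem datum36Y_of_unitary (i : KIdx d ℓ hd hL b₀ b₁) (c : ↥(cubes (toKT i).D.toDomains)) {U : CfgY (Matrix (Fin N) (Fin N) ℂ) i} {a₁ : ℝ}
    (hU : ∀ μ x, U μ x ∈ unitaryUnits (Matrix (Fin N) (Fin N) ℂ)) (h : Datum36UY i c U a₁) : Datum36Y i c U a₁ := by
  obtain ⟨g, A, Q, C, ξ, Λ, α₀', hu, hC, hξ, hΛ, hΛξ, hQ, hgA, hA, hdA, hα₁, hα4, hα', hα3, hα4', hsmall, hc₃, hsm⟩ := h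
  exact ⟨g, A, Q, C, ξ, Λ, α₀', hC, hξ, hΛ, hΛξ, hQ, hgA, hA, hdA, hα₁, hα4, hα', hα3, hα4', hsmall, hc₃, hsm, hR_of_unitary i hu hU, hg_of_unitary i hu⟩

variable {Mstar : ℕ}

/-- ★★ **THE HEADS' ROW `h36b` AT A MEMBER FOR A UNITARY-VALUED `U`, FROM THE UNITARY DATUM** — `h36b_at_member` read at `Datum36UY` (dag-n06-c ✓`gpDir_at_member_blocks_unitary`'s
display: the (3.35) datum `(g, A, Q, C, ξ, Λ)` of `Ω₀(□)` with `g` unitary and `2CΛ² ≤ gpd36a₁`, p06's numerics at `α₀′`, the thresholds `gpd36M₀ ≤ L·M_h`, `gpd36N₀ + 1 ≤ R·L·M_h`,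
`gpd36T₀ ≤ RM1`, and `U` unitary-valued — at the heads: the record's `Reg335` class membership): the four (3.42) block majorants of `η²G′_□(U)` over `toB6 (geoBY x) 1 H` at any
dominated `(B_c, δ₀)`. [cite: Balaban1985BackgroundPropagators, Cor. 3.6 p.408 l.1–14, Thm 3.1 (3.42) p.397, p.409 l.1–5, (3.35) p.396; Balaban1984PropagatorsII, (2.51)–(2.55) p.232] -/
theorem h36b_at_member_unitary {θd θℓ : ℕ} {θhd : 1 ≤ θd + 1} {θhL : Odd (θℓ + 1) ∧ 1 < θℓ + 1} {θb₀ θb₁ : ℝ}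
    (x : MemberY θd θℓ θhd θhL θb₀ θb₁ Mstar) [Fintype (geoBY x).Site] (H : Prop)
    (hM : gpd36M₀ N θd θℓ θhL ≤ ((θℓ : ℝ) + 1) * (toKT x.toKIdx).Mh) (hN : gpd36N₀ N θd θℓ θhL + 1 ≤ (toKT x.toKIdx).R * ((θℓ + 1) * (toKT x.toKIdx).Mh))
    (hT : gpd36T₀ N θd θℓ θhL ≤ RM1 x.toKIdx) (U : CfgY (Matrix (Fin N) (Fin N) ℂ) x.toKIdx) (hU : ∀ μ z, U μ z ∈ unitaryUnits (Matrix (Fin N) (Fin N) ℂ))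
    (hDat : ∀ c' : ↥(cubes x.toKIdx.D.toDomains), Datum36UY x.toKIdx c' U (gpd36a₁ N θd θℓ θhL))
    {Bc δ₀ : ℝ} (hBc : gpd36B N θd θℓ θhL ≤ Bc) (hδ : δ₀ ≤ gpd36δ N θd θℓ θhL) :
    (∀ c', HasMajorant (g := toB6 (geoBY x) 1 H) (fun p' : SiteY x.toKIdx × TrIdx N => blkOf x.toKIdx.D.toDomains p'.1)
        (conj (trBasis N) ((etaS x.toKIdx ^ 2) • (GpDirY x.toKIdx c' (parKnitCubeY x.toKIdx c') (dirDomY x.toKIdx c') U).restrictScalars ℝ))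
        (fun s s' => Bc * (geoBY x).len s ^ 2 * Real.exp (-(δ₀ * (geoBY x).dist s s')))) ∧
    (∀ c' (μ : Fin (θd + 1)), HasMajorant (g := toB6 (geoBY x) 1 H) (fun p' : SiteY x.toKIdx × TrIdx N => blkOf x.toKIdx.D.toDomains p'.1)
        (conj (trBasis N) (diffLetter (shiftY x.toKIdx) (UboxY x.toKIdx U) (((etaS x.toKIdx : ℂ))⁻¹) (Sum.inl μ)) *
          conj (trBasis N) ((etaS x.toKIdx ^ 2) • (GpDirY x.toKIdx c' (parKnitCubeY x.toKIdx c') (dirDomY x.toKIdx c') U).restrictScalars ℝ))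
        (fun s s' => Bc * (geoBY x).len s * Real.exp (-(δ₀ * (geoBY x).dist s s')))) ∧
    (∀ c' (μ : Fin (θd + 1)), HasMajorant (g := toB6 (geoBY x) 1 H) (fun p' : SiteY x.toKIdx × TrIdx N => blkOf x.toKIdx.D.toDomains p'.1)
        (conj (trBasis N) ((etaS x.toKIdx ^ 2) • (GpDirY x.toKIdx c' (parKnitCubeY x.toKIdx c') (dirDomY x.toKIdx c') U).restrictScalars ℝ) *
          conj (trBasis N) (diffLetter (shiftY x.toKIdx) (UboxY x.toKIdx U) (((etaS x.toKIdx : ℂ))⁻¹) (Sum.inr μ)))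
        (fun s s' => Bc * (geoBY x).len s * Real.exp (-(δ₀ * (geoBY x).dist s s')))) ∧
    (∀ c', HasMajorant (g := toB6 (geoBY x) 1 H) (fun p' : SiteY x.toKIdx × TrIdx N => blkOf x.toKIdx.D.toDomains p'.1)
        (conj (trBasis N) (((etaS x.toKIdx ^ 2)⁻¹) • (lapSL x.toKIdx U).restrictScalars ℝ) *
          conj (trBasis N) ((etaS x.toKIdx ^ 2) • (GpDirY x.toKIdx c' (parKnitCubeY x.toKIdx c') (dirDomY x.toKIdx c') U).restrictScalars ℝ))
        (fun s s' => Bc * 1 * Real.exp (-(δ₀ * (geoBY x).dist s s')))) :=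
  h36b_at_member x H hM hN hT U (fun c' => datum36Y_of_unitary x.toKIdx c' hU (hDat c')) hBc hδ

end Unitary

end Literature.MathematicalPhysics.QuantumFieldTheory.Balaban1983to89.B9Cor36GpDirMemberBlocksAtRecordY

end
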